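import Literature.NumberTheory.Automorphic.HermitianLatticesAnisotropicKernel
import Literature.NumberTheory.Automorphic.UnitaryLatticeTreeFramed
import Literature.NumberTheory.Automorphic.UnitaryGroupFrameEmbedding
import Literature.NumberTheory.Automorphic.ArchCongruenceTransport
import Literature.NumberTheory.Automorphic.IwasawaDecompositionGL
import HarnessLib

/-!
# The maximal lattice of an anisotropic hermitian space is `g · 𝒪ⁿ`; NORMALISED anisotropic kernels (`Λ = 𝒪ⁿ` after a congruence)
# (O'Meara §81:11, §91A; Jacobowitz 1962 §4; Bruhat–Tits 1972 (4.4.3))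

Topic `NumberTheory/Automorphic`; namespace `Literature.NumberTheory.Automorphic.HermitianLattice`.  THEOREMS only; no definition, no instance,
no notation, no named fact, no `sorry`.  Sequel of ★ `HermitianLatticesAnisotropicKernel` (the maximal lattice `Λ = {x | |h(x,x)| ≤ 1}` of an
anisotropic `σ`-hermitian `H`, by its membership predicate).

**The point.**  Over a discretely valued field with PRINCIPAL valuation ring (`[IsPrincipalIdealRing 𝒪]`) and compact `𝒪`, the maximal lattice is
sandwiched `ϖ^a 𝒪ⁿ ≤ Λ ≤ ϖ^{-b} 𝒪ⁿ` (★ §3 of the previous file), hence is `latt g = g · 𝒪ⁿ` for some `g ∈ GL_n(K)` (★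
`UnitaryLatticeTree.exists_eq_latt_of_latt_le_of_le_latt`, the PID structure theorem).  Replacing `H` by the CONGRUENT form `H′ = σ(g)ᵀ H g`
(★ `formCongr σ g H`; `h′(x, y) = h(gx, gy)`, ★ `hermForm_mulVec_mulVec_eq_hermForm_formCongr`) the maximal lattice of `H′` IS the standard
lattice `𝒪ⁿ`: **every anisotropic hermitian space has a NORMALISED model whose maximal lattice is `𝒪ⁿ`**.  Consequence for the cell's 13a road
(item (D), Witt type `(r, m = 2)`): for `W = wittFormOn e Han′` with a normalised kernel the Bruhat–Tits lattice `𝒪^r ⊕ Λ ⊕ 𝒪^r` IS `𝒪^N`, its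
stabiliser IS ★ `unitaryInt σ W`, and every `m = 2` statement can be typed in the `m ≤ 1` currency (admissibility moves between `Han` and
`Han′` by ★ congruence transport).

* `smul_mem_latt_zpowDiagGL_const`, `mem_latt_zpowDiagGL_const_iff` — membership in `latt (diag(ϖ^c, …, ϖ^c)) = ϖ^c 𝒪ⁿ`.
* **`exists_GL_forall_mem_latt_iff`** — `∃ g : GL_n(K), ∀ x, x ∈ latt g ↔ |h(x,x)| ≤ 1` (the maximal lattice is `g · 𝒪ⁿ`).
* **`exists_formCongr_maximalLattice_eq_stdLattice`** — `∃ g : GL_n(K)`, `H′ = formCongr σ g H` is `σ`-hermitian, anisotropic, and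
  `|h′(x,x)| ≤ 1 ↔ x ∈ 𝒪ⁿ`; moreover `h′` is `𝒪`-valued on `𝒪ⁿ × 𝒪ⁿ` (★ Cauchy–Schwarz), i.e. `H′` is an INTEGRAL matrix whose maximal lattice is
  exactly `𝒪ⁿ`.

Hypotheses: `hσ`, `hvσ`, (norm) `hnorm` (unramified and tamely ramified places; see the previous file), `hϖ : v ϖ = exp (-1)`,
`[CompactSpace 𝒪[K]]`, `[IsPrincipalIdealRing 𝒪[K]]` (both automatic for `K = E_w`, ★ `isPrincipalIdealRing_valuationSubring_adicCompletion`).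
HONEST LABEL: HC_CM is proved only modulo the 7 printed citations (2 remaining named inputs: hLiu418 = stmt-HodgeConjecture-24832, h413 =
stmt-HodgeConjecture-24833) until rung 0 closes; unconditional local algebra (cell hodgecm-mathlib, crux H413, 13a road A (D1)(ii-a)).

References: O. T. O'Meara, *Introduction to Quadratic Forms* (1963), §81:11 (lattices over a PID are free), §91A Thm. 91:1 [Omeara1963];
R. Jacobowitz, Amer. J. Math. 84 (1962), §4 [Jacobowitz1962]; G. Shimura, Ann. of Math. 79 (1964), §§2–3 [Shimura1964];
F. Bruhat, J. Tits, Publ. IHÉS 41 (1972), (4.4.3) [BruhatTits1972].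
-/

noncomputable section

open scoped Valued WithZero Matrix MatrixGroups
open Matrix

namespace Literature.NumberTheory.Automorphic.HermitianLattice

open Literature.NumberTheory.Automorphic Literature.NumberTheory.Automorphic.UnitaryGroup
open Literature.NumberTheory.Automorphic.UnitaryLatticeTree

variable {K : Type*} [Field K] [Valued K ℤᵐ⁰] {σ : K →+* K} {ϖ : K} {N : ℕ} {H : Matrix (Fin N) (Fin N) K}

/-! ## §1 The scalar lattices `ϖ^c 𝒪ⁿ = latt (diag ϖ^c)` -/

omit [Valued K ℤᵐ⁰] in
/-- A scalar diagonal matrix acts by the scalar: `diag(c, …, c) · y = c • y`. [cite: Omeara1963, §81A] -/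
private theorem diagonal_const_mulVec (c : K) (y : Fin N → K) : ((Matrix.diagonal fun _ : Fin N => c) *ᵥ y) = c • y :=
  funext fun i => by rw [Matrix.mulVec_diagonal, Pi.smul_apply, smul_eq_mul]

/-- `ϖ^c • y ∈ latt (diag(ϖ^c))` for `y ∈ 𝒪ⁿ`. [cite: Omeara1963, §81A] -/
theorem smul_mem_latt_zpowDiagGL_const (hϖ0 : ϖ ≠ 0) (c : ℤ) {y : Fin N → K} (hy : y ∈ stdLattice K N) :
    (ϖ ^ c) • y ∈ latt ((zpowDiagGL hϖ0 (fun _ : Fin N => c) : GL (Fin N) K) : Matrix (Fin N) (Fin N) K) := by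
  refine ⟨y, hy, ?_⟩
  rw [LinearMap.coe_restrictScalars, Matrix.toLin'_apply, coe_zpowDiagGL, diagonal_const_mulVec]

/-- If `x ∈ latt (diag(ϖ^{-c}))` then `ϖ^c • x ∈ 𝒪ⁿ`; conversely. [cite: Omeara1963, §81A] -/
theorem mem_latt_zpowDiagGL_const_iff (hϖ0 : ϖ ≠ 0) (c : ℤ) (x : Fin N → K) :
    x ∈ latt ((zpowDiagGL hϖ0 (fun _ : Fin N => -c) : GL (Fin N) K) : Matrix (Fin N) (Fin N) K) ↔ (ϖ ^ c) • x ∈ stdLattice K N := by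
  constructor
  · rintro ⟨y, hy, rfl⟩
    rw [LinearMap.coe_restrictScalars, Matrix.toLin'_apply, coe_zpowDiagGL, diagonal_const_mulVec, smul_smul, ← zpow_add₀ hϖ0,
      add_neg_cancel, zpow_zero, one_smul]
    exact hy
  · intro hx
    have h := smul_mem_latt_zpowDiagGL_const hϖ0 (-c) hx
    rwa [smul_smul, ← zpow_add₀ hϖ0, neg_add_cancel, zpow_zero, one_smul] at h

/-! ## §2 The maximal lattice is `g · 𝒪ⁿ` -/

/-- **The maximal lattice of an anisotropic hermitian space is `g · 𝒪ⁿ` for some `g ∈ GL_n(K)`** (principal, compact valuation ring): by ★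
`exists_maximalLattice` and the sandwich `ϖ^a 𝒪ⁿ ≤ Λ ≤ ϖ^{-b} 𝒪ⁿ` (★ `exists_pow_smul_mem_of_mem_stdLattice`, ★
`exists_pow_smul_mem_stdLattice_of_v_hermForm_le`), ★ `UnitaryLatticeTree.exists_eq_latt_of_latt_le_of_le_latt` applies.
[cite: Omeara1963, §81:11, §91A Thm. 91:1] [cite: Shimura1964, §2] -/
theorem exists_GL_forall_mem_latt_iff [CompactSpace 𝒪[K]] [IsPrincipalIdealRing 𝒪[K]] (hϖ : Valued.v ϖ = WithZero.exp (-1 : ℤ))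
    (hσ : ∀ a, σ (σ a) = a) (hvσ : ∀ a, Valued.v (σ a) = Valued.v a)
    (hnorm : ∀ u : K, σ u = u → Valued.v (u - 1) < 1 → ∃ z : K, z * σ z = u ∧ Valued.v (z - 1) ≤ Valued.v (u - 1))
    (hH : (H.map σ)ᵀ = H) (han : ∀ x : Fin N → K, hermForm σ H x x = 0 → x = 0) :
    ∃ g : GL (Fin N) K, ∀ x, x ∈ latt (g : Matrix (Fin N) (Fin N) K) ↔ Valued.v (hermForm σ H x x) ≤ 1 := by
  have hϖ0 : ϖ ≠ 0 := fun h0 => by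
    rw [h0, map_zero] at hϖ
    exact WithZero.coe_ne_zero hϖ.symm
  obtain ⟨Λ, hmem, -, -, -⟩ := exists_maximalLattice hσ hvσ hnorm hH han
  obtain ⟨a, ha⟩ := exists_pow_smul_mem_of_mem_stdLattice (σ := σ) hϖ hvσ H
  obtain ⟨b, hb⟩ := exists_pow_smul_mem_stdLattice_of_v_hermForm_le (σ := σ) (H := H) hϖ hvσ han
  -- `latt (diag ϖ^a) ≤ Λ ≤ latt (diag ϖ^{-b})`
  have hlo : latt ((zpowDiagGL hϖ0 (fun _ : Fin N => (a : ℤ)) : GL (Fin N) K) : Matrix (Fin N) (Fin N) K) ≤ Λ := by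
    rintro _ ⟨y, hy, rfl⟩
    rw [hmem, LinearMap.coe_restrictScalars, Matrix.toLin'_apply, coe_zpowDiagGL, diagonal_const_mulVec, zpow_natCast]
    exact ha y hy
  have hhi : Λ ≤ latt ((zpowDiagGL hϖ0 (fun _ : Fin N => -(b : ℤ)) : GL (Fin N) K) : Matrix (Fin N) (Fin N) K) := by
    intro x hx
    rw [mem_latt_zpowDiagGL_const_iff, zpow_natCast, mem_stdLattice]
    intro i
    exact hb x ((hmem x).1 hx) i
  obtain ⟨g, hg⟩ := exists_eq_latt_of_latt_le_of_le_latt _ _ Λ hlo hhi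
  exact ⟨g, fun x => by rw [← hg, hmem]⟩

/-! ## §3 Normalised anisotropic kernels -/

/-- **NORMALISED MODEL OF AN ANISOTROPIC HERMITIAN SPACE**: there is `g ∈ GL_n(K)` such that the congruent form `H′ = σ(g)ᵀ H g`
(★ `formCongr σ g H`) is `σ`-hermitian and anisotropic, its maximal lattice is EXACTLY `𝒪ⁿ` (`|h′(x,x)| ≤ 1 ↔ x ∈ 𝒪ⁿ`), and `h′` is `𝒪`-valued on
`𝒪ⁿ × 𝒪ⁿ` (so `H′` is an integral matrix).  For such kernels the Bruhat–Tits lattice `𝒪^r ⊕ Λ ⊕ 𝒪^r` of the Witt form is `𝒪^N` and its stabiliser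
is ★ `unitaryInt`. [cite: Omeara1963, §91A Thm. 91:1] [cite: Jacobowitz1962, §4] [cite: BruhatTits1972, (4.4.3)] -/
theorem exists_formCongr_maximalLattice_eq_stdLattice [CompactSpace 𝒪[K]] [IsPrincipalIdealRing 𝒪[K]]
    (hϖ : Valued.v ϖ = WithZero.exp (-1 : ℤ)) (hσ : ∀ a, σ (σ a) = a) (hvσ : ∀ a, Valued.v (σ a) = Valued.v a)
    (hnorm : ∀ u : K, σ u = u → Valued.v (u - 1) < 1 → ∃ z : K, z * σ z = u ∧ Valued.v (z - 1) ≤ Valued.v (u - 1))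
    (hH : (H.map σ)ᵀ = H) (han : ∀ x : Fin N → K, hermForm σ H x x = 0 → x = 0) :
    ∃ g : GL (Fin N) K,
      ((formCongr σ g H).map σ)ᵀ = formCongr σ g H ∧
      (∀ x : Fin N → K, hermForm σ (formCongr σ g H) x x = 0 → x = 0) ∧
      (∀ x : Fin N → K, Valued.v (hermForm σ (formCongr σ g H) x x) ≤ 1 ↔ x ∈ stdLattice K N) ∧
      (∀ x ∈ stdLattice K N, ∀ y ∈ stdLattice K N, Valued.v (hermForm σ (formCongr σ g H) x y) ≤ 1) := by
  obtain ⟨g, hg⟩ := exists_GL_forall_mem_latt_iff hϖ hσ hvσ hnorm hH han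
  -- anisotropy of the congruent form
  have han' : ∀ x : Fin N → K, hermForm σ (formCongr σ g H) x x = 0 → x = 0 := by
    intro x hx
    rw [← hermForm_mulVec_mulVec_eq_hermForm_formCongr] at hx
    have h1 := han _ hx
    have h2 : ((g⁻¹ : GL (Fin N) K) : Matrix (Fin N) (Fin N) K) *ᵥ ((g : Matrix (Fin N) (Fin N) K) *ᵥ x) = x := by
      rw [Matrix.mulVec_mulVec, ← Units.val_mul, inv_mul_cancel, Units.val_one, Matrix.one_mulVec]
    rw [← h2, h1, Matrix.mulVec_zero]
  -- `g x ∈ latt g ↔ x ∈ 𝒪ⁿ`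
  have hlatt : ∀ x : Fin N → K, (g : Matrix (Fin N) (Fin N) K) *ᵥ x ∈ latt (g : Matrix (Fin N) (Fin N) K) ↔ x ∈ stdLattice K N := by
    intro x
    constructor
    · rintro ⟨y, hy, hyx⟩
      rw [LinearMap.coe_restrictScalars, Matrix.toLin'_apply] at hyx
      have : y = x := by
        have h := congrArg (fun z => ((g⁻¹ : GL (Fin N) K) : Matrix (Fin N) (Fin N) K) *ᵥ z) hyx
        simpa only [Matrix.mulVec_mulVec, ← Units.val_mul, inv_mul_cancel, Units.val_one, Matrix.one_mulVec] using h
      rw [← this]; exact hy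
    · intro hx
      exact ⟨x, hx, by rw [LinearMap.coe_restrictScalars, Matrix.toLin'_apply]⟩
  have hmem : ∀ x : Fin N → K, Valued.v (hermForm σ (formCongr σ g H) x x) ≤ 1 ↔ x ∈ stdLattice K N := fun x => by
    rw [← hermForm_mulVec_mulVec_eq_hermForm_formCongr, ← hg, hlatt]
  refine ⟨g, transpose_map_formCongr σ hσ g hH, han', hmem, fun x hx y hy => ?_⟩
  -- integrality on `𝒪ⁿ × 𝒪ⁿ` by Cauchy–Schwarz for the congruent (anisotropic, hermitian) form
  have hx' := (hmem x).2 hx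
  have hy' := (hmem y).2 hy
  have hcs := v_hermForm_mul_self_le hσ hvσ hnorm (transpose_map_formCongr σ hσ g hH) han' x y
  by_contra hgt
  rw [not_le] at hgt
  have h2 : Valued.v (hermForm σ (formCongr σ g H) x x) * Valued.v (hermForm σ (formCongr σ g H) y y) ≤ 1 * 1 := mul_le_mul' hx' hy'
  rw [mul_one] at h2
  exact not_lt_of_ge (hcs.trans h2) (one_lt_mul'' hgt hgt)

end Literature.NumberTheory.Automorphic.HermitianLattice

end
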